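import Summits.Ventures.HSemireg.WedgeHankelRecurrenceGaussChebyshevLevelSetMultiplicities

/-!
# Venture HSemireg — **THE GENERIC CHEBYSHEV LEVEL SETS ARE SIMPLE: for `sin φ ≠ 0` (i.e. `|cos φ| < 1`) and `n ≥ 1`, `(T_n − cos φ).roots = {cos((φ + 2jπ)∕n) : j < n}` and
# `(C_n − 2cos φ).roots = {2cos((φ + 2jπ)∕n) : j < n}`, `n` DISTINCT real roots** — equivalently, for `−1 < c < 1` the equation `T_n(x) = c` has exactly the `n` simple real solutions
# `x_j = cos((arccos c + 2jπ)∕n)`, and for `−2 < c < 2` the equation `C_n(x) = c` the `n` simple solutions `2cos((arccos(c∕2) + 2jπ)∕n)` (contrast N504 ∕ N502: at `c = ±1`, resp. `±2`, the interior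
# roots collide in pairs)

HONEST FRAMING. Part of the Lean index of the computation cell `pub-hsemireg` (seat p10 gen 49, Sunday typer «UNIFORM-IN-n»).  Real polynomial algebra and trigonometry only (Mathlib
`Polynomial.Chebyshev.T ∕ C`, `Polynomial.roots`, `Real.cos ∕ arccos`); no variety, no cohomology theory, no sheaf, no Ext group and no semiregularity map is constructed here; nothing here says
that HC / HC_CM / HC_AV holds; no Literature fact (unproved `Prop`) is declared or used.  Custodian versions as in `WedgeHankelSiegelIdeal` (1/3).
SOURCES (cited).  T. J. Rivlin, *The Chebyshev Polynomials* (1974), §1.2 and Ex. 1.2.4–1.2.5 (`T_n(x) = c`, `|c| < 1`, has `n` distinct solutions in `(−1, 1)`); J. C. Mason, D. C. Handscomb,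
*Chebyshev Polynomials* (2003), §2.2; G. Szegő, *Orthogonal Polynomials*, §6.3.
PROOF TYPED HERE.  Mathlib `T_real_cos` ∕ `C_two_mul_real_cos` and `cos_add_nat_mul_two_pi` make every `cos((φ + 2jπ)∕n)` a solution; DISTINCTNESS: by Mathlib `Real.cos_eq_cos_iff`, a coincidence
`cos((φ+2iπ)∕n) = cos((φ+2jπ)∕n)` with `i, j < n` forces either `j = kn + i` (so `k = 0`, `i = j`) or `φ = (kn − i − j)π`, excluded by `sin φ ≠ 0` (`Real.sin_int_mul_pi`); the degree count
(`deg(T_n − c) = n`, Mathlib `degree_T`; `deg(C_n − c) = n`, `Literature…ChebyshevChains`) closes with `roots_eq_of_degree_eq_card`; the `arccos` forms via `Real.cos_arccos`, `arccos_pos`, `arccos_lt_pi`.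
DEDUP DISCLOSURE (`rg -n 'LevelSet|sub_C_cos|eval_eq_cos_iff' Summits/Ventures/HSemireg`, `lean search`, 2026-09-04): Mathlib has `abs_eval_T_real_le_one_iff`, `eval_T_real_eq_one_iff` and the
`±1` level sets only; N502 ∕ N504 the `±2`, `±1` multisets; the generic simple level sets below are not in the tree; 0 hits for the 9 names below.

WHAT IS IN THE TREE.  Mathlib `T_real_cos`, `C_two_mul_real_cos`, `cos_eq_cos_iff`, `degree_T`; `Literature…ChebyshevChains.monic_chebyshevC_and_natDegree`; N502, N504 (degenerate levels).
THIS FILE (namespace `Summit.Ventures.HSemireg.Wedge.HankelOuter` continued; CHAINED on N505; 0 definitions):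
* §1271 `cos_levelSet_injOn` (distinctness), `chebyshevT_levelSet_nodup`, **`chebyshevT_sub_C_cos_roots_real`**, **`chebyshevT_eval_eq_cos_iff_real`**, **`chebyshevT_sub_C_roots_real_of_abs_lt_one`**
  (`arccos` form, `−1 < c < 1`), `chebyshevC_levelSet_nodup`, **`chebyshevC_sub_C_two_mul_cos_roots_real`**, **`chebyshevC_eval_eq_two_mul_cos_iff_real`**, **`chebyshevC_sub_C_roots_real_of_abs_lt_two`**.
CAVEATS.  `n ≥ 1`; `sin φ ≠ 0` (the levels `cos φ = ±1` are N504 ∕ N502, with double roots).  Nothing Ext-side.  New names only.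
-/

open Module Polynomial Real
open scoped Matrix Polynomial

namespace Summit.Ventures.HSemireg.Wedge.HankelOuter

/-! ## §1271. Generic level sets `T_n = cos φ`, `C_n = 2cos φ` -/

/-- **Distinctness of the generic level-set angles**: if `sin φ ≠ 0` then `j ↦ cos((φ + 2jπ)∕n)` is injective on `j < n`. [Rivlin Ex. 1.2.4; this file, §1271] -/
theorem cos_levelSet_injOn {φ : ℝ} (hφ : sin φ ≠ 0) (n : ℕ) :
    Set.InjOn (fun j : ℕ => cos ((φ + 2 * j * π) / n)) {j | j < n} := by
  intro i hi j hj hij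
  simp only [Set.mem_setOf_eq] at hi hj
  have hn : (n : ℝ) ≠ 0 := by exact_mod_cast ((Nat.zero_le i).trans_lt hi).ne'
  obtain ⟨k, hk | hk⟩ := cos_eq_cos_iff.mp hij
  · -- `(φ + 2jπ)/n = 2kπ + (φ + 2iπ)/n` ⇒ `j = kn + i` ⇒ `k = 0`
    have h1 : ((j : ℤ) : ℝ) = ((k * n + i : ℤ) : ℝ) := by
      have h := hk; field_simp at h; push_cast
      have : (2 * π) * ((j : ℝ) - (k * n + i)) = 0 := by linarith
      have h2 : (j : ℝ) - (k * n + i) = 0 := (mul_eq_zero.mp this).resolve_left (by positivity)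
      linarith
    have h2 : (j : ℤ) = k * n + i := by exact_mod_cast h1
    have hi' : (i : ℤ) < n := by exact_mod_cast hi
    have hj' : (j : ℤ) < n := by exact_mod_cast hj
    have hk0 : k = 0 := by
      rcases lt_trichotomy k 0 with hneg | rfl | hpos
      · nlinarith
      · rfl
      · nlinarith
    subst hk0
    exact_mod_cast (by simpa using h2 : (j : ℤ) = i).symm
  · -- `(φ + 2jπ)/n = 2kπ − (φ + 2iπ)/n` ⇒ `φ = (kn − i − j)π` ⇒ `sin φ = 0`
    exfalso
    have h1 : φ = ((k * n - i - j : ℤ) : ℝ) * π := by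
      have h := hk; field_simp at h; push_cast; linarith
    exact hφ (by rw [h1, sin_int_mul_pi])

/-- The points `cos((φ + 2jπ)∕n)`, `j < n`, are pairwise distinct when `sin φ ≠ 0`. [this file, §1271] -/
theorem chebyshevT_levelSet_nodup {φ : ℝ} (hφ : sin φ ≠ 0) (n : ℕ) : ((Multiset.range n).map fun j : ℕ => cos ((φ + 2 * j * π) / n)).Nodup :=
  (Multiset.nodup_range n).map_on fun _ hi _ hj h => cos_levelSet_injOn hφ n (Multiset.mem_range.mp hi) (Multiset.mem_range.mp hj) h

/-- **`(T_n − cos φ).roots = {cos((φ + 2jπ)∕n) : j < n}` over `ℝ`** (`n ≥ 1`, `sin φ ≠ 0`; `n` simple roots). [Rivlin §1.2, Ex. 1.2.4; this file, §1271] -/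
theorem chebyshevT_sub_C_cos_roots_real {φ : ℝ} (hφ : sin φ ≠ 0) {n : ℕ} (hn : n ≠ 0) :
    (Polynomial.Chebyshev.T ℝ (n : ℤ) - Polynomial.C (cos φ)).roots = (Multiset.range n).map fun j : ℕ => cos ((φ + 2 * j * π) / n) := by
  classical
  have hnd := chebyshevT_levelSet_nodup hφ n
  have hfin : ((Multiset.range n).map fun j : ℕ => cos ((φ + 2 * j * π) / n)) = (((Multiset.range n).map fun j : ℕ => cos ((φ + 2 * j * π) / n)).toFinset).val := by
    rw [Multiset.toFinset_val, Multiset.dedup_eq_self.mpr hnd]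
  have hnR : (n : ℝ) ≠ 0 := by exact_mod_cast hn
  rw [hfin]
  refine roots_eq_of_degree_eq_card (fun x hx => ?_) ?_
  · obtain ⟨j, -, rfl⟩ := Multiset.mem_map.mp (Multiset.mem_toFinset.mp hx)
    rw [eval_sub, eval_C, Polynomial.Chebyshev.T_real_cos, Int.cast_natCast, mul_div_cancel₀ _ hnR, show φ + 2 * (j : ℝ) * π = φ + j * (2 * π) by ring, cos_add_nat_mul_two_pi, sub_self]
  · rw [Multiset.card_toFinset, Multiset.dedup_eq_self.mpr hnd, Multiset.card_map, Multiset.card_range,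
      degree_sub_eq_left_of_degree_lt (by rw [Polynomial.Chebyshev.degree_T, Int.natAbs_natCast]; exact degree_C_le.trans_lt (by exact_mod_cast Nat.pos_of_ne_zero hn)),
      Polynomial.Chebyshev.degree_T, Int.natAbs_natCast]

/-- **`T_n(x) = cos φ ⇔ x = cos((φ + 2jπ)∕n)` for some `j < n`** (`x ∈ ℝ`, `n ≥ 1`, `sin φ ≠ 0`). [Rivlin §1.2; this file, §1271] -/
theorem chebyshevT_eval_eq_cos_iff_real {φ : ℝ} (hφ : sin φ ≠ 0) {n : ℕ} (hn : n ≠ 0) (x : ℝ) :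
    (Polynomial.Chebyshev.T ℝ (n : ℤ)).eval x = cos φ ↔ ∃ j < n, x = cos ((φ + 2 * j * π) / n) := by
  have hne : Polynomial.Chebyshev.T ℝ (n : ℤ) - Polynomial.C (cos φ) ≠ 0 := fun h => by
    have := congrArg Polynomial.roots h
    rw [chebyshevT_sub_C_cos_roots_real hφ hn, roots_zero, Multiset.eq_zero_iff_forall_notMem] at this
    exact this _ (Multiset.mem_map.mpr ⟨0, Multiset.mem_range.mpr (Nat.pos_of_ne_zero hn), rfl⟩)
  rw [← sub_eq_zero, ← eval_C (a := cos φ) (x := x), ← eval_sub, ← Polynomial.IsRoot.def, ← mem_roots hne, chebyshevT_sub_C_cos_roots_real hφ hn, Multiset.mem_map]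
  constructor
  · rintro ⟨j, hj, rfl⟩; exact ⟨j, Multiset.mem_range.mp hj, rfl⟩
  · rintro ⟨j, hj, rfl⟩; exact ⟨j, Multiset.mem_range.mpr hj, rfl⟩

/-- **For `−1 < c < 1`: `(T_n − c).roots = {cos((arccos c + 2jπ)∕n) : j < n}`, `n` simple real roots** (`n ≥ 1`). [Rivlin §1.2, Ex. 1.2.4–1.2.5; this file, §1271] -/
theorem chebyshevT_sub_C_roots_real_of_abs_lt_one {c : ℝ} (hc1 : -1 < c) (hc2 : c < 1) {n : ℕ} (hn : n ≠ 0) :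
    (Polynomial.Chebyshev.T ℝ (n : ℤ) - Polynomial.C c).roots = ((Multiset.range n).map fun j : ℕ => cos ((arccos c + 2 * j * π) / n)) ∧
      ((Multiset.range n).map fun j : ℕ => cos ((arccos c + 2 * j * π) / n)).Nodup := by
  have hsin : sin (arccos c) ≠ 0 := (sin_pos_of_pos_of_lt_pi (arccos_pos.mpr hc2) (arccos_lt_pi.mpr hc1)).ne'
  have h := chebyshevT_sub_C_cos_roots_real hsin hn
  rw [cos_arccos hc1.le hc2.le] at h
  exact ⟨h, chebyshevT_levelSet_nodup hsin n⟩

/-- The points `2cos((φ + 2jπ)∕n)`, `j < n`, are pairwise distinct when `sin φ ≠ 0`. [this file, §1271] -/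
theorem chebyshevC_levelSet_nodup {φ : ℝ} (hφ : sin φ ≠ 0) (n : ℕ) : ((Multiset.range n).map fun j : ℕ => 2 * cos ((φ + 2 * j * π) / n)).Nodup := by
  have h := (chebyshevT_levelSet_nodup hφ n).map (mul_right_injective₀ (two_ne_zero (α := ℝ)))
  rwa [Multiset.map_map] at h

/-- **`(C_n − 2cos φ).roots = {2cos((φ + 2jπ)∕n) : j < n}` over `ℝ`** (`n ≥ 1`, `sin φ ≠ 0`; `n` simple roots). [Rivlin §1.2 (dilated); this file, §1271] -/
theorem chebyshevC_sub_C_two_mul_cos_roots_real {φ : ℝ} (hφ : sin φ ≠ 0) {n : ℕ} (hn : n ≠ 0) :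
    (Polynomial.Chebyshev.C ℝ (n : ℤ) - Polynomial.C (2 * cos φ)).roots = (Multiset.range n).map fun j : ℕ => 2 * cos ((φ + 2 * j * π) / n) := by
  classical
  have hnd := chebyshevC_levelSet_nodup hφ n
  have hfin : ((Multiset.range n).map fun j : ℕ => 2 * cos ((φ + 2 * j * π) / n)) = (((Multiset.range n).map fun j : ℕ => 2 * cos ((φ + 2 * j * π) / n)).toFinset).val := by
    rw [Multiset.toFinset_val, Multiset.dedup_eq_self.mpr hnd]
  have hnR : (n : ℝ) ≠ 0 := by exact_mod_cast hn
  obtain ⟨m, rfl⟩ := Nat.exists_eq_add_one_of_ne_zero hn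
  obtain ⟨hmonic, hdeg⟩ := Literature.Algebra.Polynomial.ChebyshevChains.monic_chebyshevC_and_natDegree (R := ℝ) m
  rw [hfin]
  refine roots_eq_of_degree_eq_card (fun x hx => ?_) ?_
  · obtain ⟨j, -, rfl⟩ := Multiset.mem_map.mp (Multiset.mem_toFinset.mp hx)
    rw [eval_sub, eval_C, Polynomial.Chebyshev.C_two_mul_real_cos, Int.cast_natCast, mul_div_cancel₀ _ hnR, show φ + 2 * (j : ℝ) * π = φ + j * (2 * π) by ring, cos_add_nat_mul_two_pi,
      sub_self]
  · rw [Multiset.card_toFinset, Multiset.dedup_eq_self.mpr hnd, Multiset.card_map, Multiset.card_range,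
      degree_sub_eq_left_of_degree_lt (by rw [degree_eq_natDegree hmonic.ne_zero, hdeg]; exact degree_C_le.trans_lt (by exact_mod_cast Nat.succ_pos m)),
      degree_eq_natDegree hmonic.ne_zero, hdeg]

/-- **`C_n(x) = 2cos φ ⇔ x = 2cos((φ + 2jπ)∕n)` for some `j < n`** (`x ∈ ℝ`, `n ≥ 1`, `sin φ ≠ 0`). [Rivlin §1.2 (dilated); this file, §1271] -/
theorem chebyshevC_eval_eq_two_mul_cos_iff_real {φ : ℝ} (hφ : sin φ ≠ 0) {n : ℕ} (hn : n ≠ 0) (x : ℝ) :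
    (Polynomial.Chebyshev.C ℝ (n : ℤ)).eval x = 2 * cos φ ↔ ∃ j < n, x = 2 * cos ((φ + 2 * j * π) / n) := by
  have hne : Polynomial.Chebyshev.C ℝ (n : ℤ) - Polynomial.C (2 * cos φ) ≠ 0 := fun h => by
    have := congrArg Polynomial.roots h
    rw [chebyshevC_sub_C_two_mul_cos_roots_real hφ hn, roots_zero, Multiset.eq_zero_iff_forall_notMem] at this
    exact this _ (Multiset.mem_map.mpr ⟨0, Multiset.mem_range.mpr (Nat.pos_of_ne_zero hn), rfl⟩)
  rw [← sub_eq_zero, ← eval_C (a := 2 * cos φ) (x := x), ← eval_sub, ← Polynomial.IsRoot.def, ← mem_roots hne, chebyshevC_sub_C_two_mul_cos_roots_real hφ hn, Multiset.mem_map]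
  constructor
  · rintro ⟨j, hj, rfl⟩; exact ⟨j, Multiset.mem_range.mp hj, rfl⟩
  · rintro ⟨j, hj, rfl⟩; exact ⟨j, Multiset.mem_range.mpr hj, rfl⟩

/-- **For `−2 < c < 2`: `(C_n − c).roots = {2cos((arccos(c∕2) + 2jπ)∕n) : j < n}`, `n` simple real roots** (`n ≥ 1`). [Rivlin §1.2 (dilated); this file, §1271] -/
theorem chebyshevC_sub_C_roots_real_of_abs_lt_two {c : ℝ} (hc1 : -2 < c) (hc2 : c < 2) {n : ℕ} (hn : n ≠ 0) :
    (Polynomial.Chebyshev.C ℝ (n : ℤ) - Polynomial.C c).roots = ((Multiset.range n).map fun j : ℕ => 2 * cos ((arccos (c / 2) + 2 * j * π) / n)) ∧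
      ((Multiset.range n).map fun j : ℕ => 2 * cos ((arccos (c / 2) + 2 * j * π) / n)).Nodup := by
  have h1 : -1 < c / 2 := by linarith
  have h2 : c / 2 < 1 := by linarith
  have hsin : sin (arccos (c / 2)) ≠ 0 := (sin_pos_of_pos_of_lt_pi (arccos_pos.mpr h2) (arccos_lt_pi.mpr h1)).ne'
  have h := chebyshevC_sub_C_two_mul_cos_roots_real hsin hn
  rw [cos_arccos h1.le h2.le, show 2 * (c / 2) = c by ring] at h
  exact ⟨h, chebyshevC_levelSet_nodup hsin n⟩

end Summit.Ventures.HSemireg.Wedge.HankelOuter
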